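import Mathlib
import Summits.ValiantsHypothesis.ValiantsHypothesis.Theorems.BarrierLeverPartitionMinorsHitByVPHiddenStatesCoHubCells

/-!
# Route BarrierLever — item `PartitionMinorsHitByVP` (stmt-ValiantsHypothesis-19717), line `hidden-states`:
# the LOWER node at `h = 20` — the first open window after the co-hub: `547 543 ≤ r ≤ 1 032 613`

Helper file (`--supports stmt-ValiantsHypothesis-19717`; cell valiant-natproofs, rung V4, 𝒟-side door (c), registered line
`Cruxes/PartitionMinorsHitByVP/Lines/hidden_states.lean` v8; prover seat val-np-p6 gen 14). Definition-free; closes NO item.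
Bookkeeping sequel of `…HiddenStatesCoHubCells` (`universalJoinWideLower_upto_nineteen`: every `h ≤ 19`, every `r`): the two kernel
ranges of the LOWER node `LowerNode.Stmt.universalJoinWideLower` (p599518) at the first open height `h = 20`.

* `sum_choose_twenty_ten` — the degree-averaging constant `Σ_{j<10} Σ_{i≤j} C(20,i) = 923 780`.
* **`universalJoinWideLower_twenty_hub`** — every `r ≤ 547 542` (hub joins p609852 for `r ≤ 353 640`; above, `HubWide.universalJoinWide_body_lower`
  (p611381) with `t = 10` and `l = ⌈(r − 320 040)/40⌉` married pairs per piece).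
* **`universalJoinWideLower_twenty_coTop`** — every `1 032 614 ≤ r ≤ 2^20` (the co-hub, `CoHub.universalJoinWideLower_coTop_poly`, p642534).
* `lower_window_twenty` — the arithmetic: the LOWER node at `h = 20` is open exactly on `547 543 ≤ r ≤ 1 032 613` as far as the tree knows
  (`485 071` sizes, `46 %` of the cube — the bulk; at `h = 19` the two ranges met because `2^19 < 4·19⁴ + 2·19³`).

WHAT THIS IS NOT: nothing inside the window; nothing on crux 14610 or VP ≠ VNP.
-/

set_option linter.dupNamespace false

namespace Summit.ValiantsHypothesis.ValiantsHypothesis.Theorems.BarrierLever.HiddenStates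

open Finset

noncomputable section

namespace CoHub

/-- The degree-averaging constant at `h = 20`, `t = 10`: `Σ_{j<10} Σ_{i≤j} C(20,i) = 923 780`. -/
theorem sum_choose_twenty_ten :
    ∑ j ∈ Finset.range 10, ∑ i ∈ Finset.range (j + 1), Nat.choose 20 i = 923780 := by
  simp only [Finset.sum_range_succ, Finset.sum_range_zero, zero_add]
  norm_num [Nat.choose]

/-- **The LOWER node at `h = 20` for every `r ≤ 547 542`** (hub joins below `353 640`; hub joins with married pairs and the maximal-degree
coordinate of a lower family above: `20·deg ≥ 10 r − 923 780 ≥ 20·40(l+1)`). -/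
theorem universalJoinWideLower_twenty_hub (r : ℕ) (hr : r ≤ 547542) :
    ∃ (m K : ℕ) (W : Fin m → ℕ) (wt : Fin m → Fin K → ℕ) (e : Fin r → Fin m × Finset (Fin K)),
      m ≤ 20 + 20 ∧ K ≤ 20 * 20 * 20 ∧ Function.Injective e ∧
      (∀ x : Fin m × Finset (Fin K), x ∉ Set.range e →
        ∀ i, W (e i).1 + ∑ k ∈ (e i).2, wt (e i).1 k < W x.1 + ∑ k ∈ x.2, wt x.1 k) ∧
      ∀ u : Fin r → Finset (Fin 20), Function.Injective u → IsLowerSet (Set.range u) →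
        ∃ tx : Fin m → Option (Fin K) → Fin 20 → ℂ,
          (Matrix.of fun i k : Fin r =>
            ∏ a ∈ u i, (tx (e k).1 none a + ∑ q ∈ (e k).2, tx (e k).1 (some q) a)).det ≠ 0 := by
  by_cases hsmall : r ≤ (20 + 20) * (20 * 20 * 20 + 1) + 4 * (20 * 20 * 20) + 4 * (20 * 20)
  · obtain ⟨m, K, W, wt, e, hm, hK, he, hthr, hgood⟩ := HubWide.universalJoinWide_of_le_hub 20 r (by norm_num) hsmall
    exact ⟨m, K, W, wt, e, hm, hK, he, hthr, fun u hu _ => hgood u hu⟩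
  push Not at hsmall
  set l := (r - (20 + 20) * (20 * 20 * 20 + 1) + 39) / 40 with hl
  refine HubWide.universalJoinWide_body_lower 20 l r 10 (by norm_num) ?_ ?_ ?_
  · omega
  · omega
  · rw [sum_choose_twenty_ten]
    omega

/-- **The LOWER node at `h = 20` for every `1 032 614 ≤ r ≤ 2^20`** (the co-hub: co-size `≤ 15 962 = 2·20³ − 2·20 + 2`). -/
theorem universalJoinWideLower_twenty_coTop (r : ℕ) (hlo : 1032614 ≤ r) (hr : r ≤ 2 ^ 20) :
    ∃ (m K : ℕ) (W : Fin m → ℕ) (wt : Fin m → Fin K → ℕ) (e : Fin r → Fin m × Finset (Fin K)),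
      m ≤ 20 + 20 ∧ K ≤ 20 * 20 * 20 ∧ Function.Injective e ∧
      (∀ x : Fin m × Finset (Fin K), x ∉ Set.range e →
        ∀ i, W (e i).1 + ∑ k ∈ (e i).2, wt (e i).1 k < W x.1 + ∑ k ∈ x.2, wt x.1 k) ∧
      ∀ u : Fin r → Finset (Fin 20), Function.Injective u → IsLowerSet (Set.range u) →
        ∃ tx : Fin m → Option (Fin K) → Fin 20 → ℂ,
          (Matrix.of fun i k : Fin r =>
            ∏ a ∈ u i, (tx (e k).1 none a + ∑ q ∈ (e k).2, tx (e k).1 (some q) a)).det ≠ 0 :=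
  universalJoinWideLower_coTop_poly 20 r (by norm_num) hr (by norm_num; omega)

/-- Window arithmetic at `h = 20`: the two kernel ranges of the LOWER node are `r ≤ 547 542` and `r ≥ 1 032 614 = 2^20 − 15 962`; the open
window has `1 032 613 − 547 542 = 485 071` sizes. (At `h = 19`: `2^19 = 524 288 ≤ 517 158 + 13 682`, which is why that window closed.) -/
theorem lower_window_twenty :
    2 ^ 20 - (2 * (20 * 20 * 20) + 2 - 2 * 20) = 1032614 ∧ 1032613 - 547542 = 485071 ∧
      (2 : ℕ) ^ 19 ≤ 517158 + 13682 := by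
  norm_num

end CoHub

end

end Summit.ValiantsHypothesis.ValiantsHypothesis.Theorems.BarrierLever.HiddenStates
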